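import Summits.Schanuel.Schanuel.Theorems.RootDecomp1HSpineSubst

/-!
# RootDecomp1HSpine — continuation (RootDecomp1HSpineHeight): §6 heights under the cyclic substitution: the census certificate (Euclidean / sup-norm image exclusion) ⟹ source exclusion (l1 … bridge_cell_iff_of_imgExclN, hBound)

Part of the six-file split (400-line rule) of lens 5's gen-11 node «CyclicSpine» = HOME/decomp-schanuel-lens-5/g11/Spine.lean
(sha256 ea4c5941…; ROUND 11 of route-Schanuel-RootDecomp1H, a THEOREM ROUND; `--supports stmt-Schanuel-30564`). All parts share the namespace
`Summit.Schanuel.Schanuel.Theorems.RootDecomp1HSpine` and the header block of the node; the module docstring of the first part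
(`RootDecomp1HSpineRigid`) describes the whole node. Sorry-free; standard axioms. Nothing here proves Schanuel; rung 0.
-/

set_option linter.dupNamespace false

noncomputable section

namespace Summit.Schanuel.Schanuel.Theorems.RootDecomp1HSpine

open Complex Set
open Literature.NumberTheory.Transcendental (exists_nsmul_mem_span_int mem_adjoin_of_mem_span_int SchanuelRank Khovanskii.ePD)
open Summit.Schanuel.Schanuel.Theses.RootDecomp1H (ProductSchanuel RelTowerSchanuel BridgeTransverse FinCS)
open Summit.Schanuel.Schanuel.Theorems.RootDecomp1HTowerCells (trdeg_adjoin_adjoin_eq trdeg_adjoin_union_le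
  trdeg_adjoin_range_le)
open Summit.Schanuel.Schanuel.Theorems.RootDecomp1HCurveHull
open Summit.Schanuel.Schanuel.Theorems.RootDecomp1HClearance (LowerRanks CounterEx InTowerHull)
open Summit.Schanuel.Schanuel.Theorems.RootDecomp1HWitness
open Summit.Schanuel.Schanuel.Theorems.RootDecomp1HGauge
open Summit.Schanuel.Schanuel.Theorems.RootDecomp1HCycles (ratCast_mem mem_closure_of_isAlgebraic_closure mem_closure_of_pair)

/-! ## 6. Heights under the cyclic substitution: the census certificate (Euclidean / sup-norm image exclusion) ⟹ source exclusion -/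

section height

/-- The `ℓ¹`-NORM of an integer polynomial: the sum of the absolute values of its coefficients. -/
def l1 {σ : Type*} (G : MvPolynomial σ ℤ) : ℕ := G.support.sum fun m => (G.coeff m).natAbs

variable {σ : Type*}

/-- `(G.coeff m).natAbs ≤ l1 G`. -/
theorem natAbs_coeff_le_l1 (G : MvPolynomial σ ℤ) (m : σ →₀ ℕ) : (G.coeff m).natAbs ≤ l1 G := by
  by_cases hm : m ∈ G.support
  · exact Finset.single_le_sum (f := fun m => (G.coeff m).natAbs) (fun _ _ => Nat.zero_le _) hm
  · rw [MvPolynomial.notMem_support_iff.1 hm]; exact Nat.zero_le _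

/-- The `ℓ¹`-height `l1 G` may be summed over any finite set containing the support. -/
theorem l1_eq_sum_of_subset {G : MvPolynomial σ ℤ} {S : Finset (σ →₀ ℕ)} (h : G.support ⊆ S) :
    l1 G = S.sum fun m => (G.coeff m).natAbs :=
  Finset.sum_subset h fun m _ hm => by simp [MvPolynomial.notMem_support_iff.1 hm]

/-- `l1 (G + H) ≤ l1 G + l1 H`. -/
theorem l1_add_le (G H : MvPolynomial σ ℤ) : l1 (G + H) ≤ l1 G + l1 H := by
  classical
  obtain ⟨S, hS, hGS, hHS⟩ : ∃ S : Finset (σ →₀ ℕ), (G + H).support ⊆ S ∧ G.support ⊆ S ∧ H.support ⊆ S :=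
    ⟨_, MvPolynomial.support_add, Finset.subset_union_left, Finset.subset_union_right⟩
  rw [l1_eq_sum_of_subset hS, l1_eq_sum_of_subset hGS, l1_eq_sum_of_subset hHS, ← Finset.sum_add_distrib]
  exact Finset.sum_le_sum fun m _ => by rw [MvPolynomial.coeff_add]; exact Int.natAbs_add_le _ _

/-- `l1` is subadditive over finite sums. -/
theorem l1_sum_le {ι : Type*} (s : Finset ι) (f : ι → MvPolynomial σ ℤ) :
    l1 (∑ i ∈ s, f i) ≤ ∑ i ∈ s, l1 (f i) := by
  classical
  induction s using Finset.induction_on with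
  | empty => simp [l1]
  | @insert a s ha ih =>
    rw [Finset.sum_insert ha, Finset.sum_insert ha]
    exact (l1_add_le _ _).trans (add_le_add le_rfl ih)

/-- `l1 (MvPolynomial.monomial m a) = a.natAbs`. -/
theorem l1_monomial (m : σ →₀ ℕ) (a : ℤ) : l1 (MvPolynomial.monomial m a) = a.natAbs := by
  classical
  rw [l1, MvPolynomial.support_monomial]
  by_cases ha : a = 0
  · rw [if_pos ha, Finset.sum_empty, ha]; rfl
  · rw [if_neg ha, Finset.sum_singleton, MvPolynomial.coeff_monomial, if_pos rfl]

/-- `l1 (MvPolynomial.C a : MvPolynomial σ ℤ) = a.natAbs`. -/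
theorem l1_C (a : ℤ) : l1 (MvPolynomial.C a : MvPolynomial σ ℤ) = a.natAbs := by
  rw [MvPolynomial.C_apply]; exact l1_monomial 0 a

/-- `l1 (MvPolynomial.X s : MvPolynomial σ ℤ) = 1`. -/
theorem l1_X (s : σ) : l1 (MvPolynomial.X s : MvPolynomial σ ℤ) = 1 := by
  rw [MvPolynomial.X, l1_monomial]; rfl

/-- `l1 (1 : MvPolynomial σ ℤ) = 1`. -/
theorem l1_one : l1 (1 : MvPolynomial σ ℤ) = 1 := by
  rw [← MvPolynomial.C_1, l1_C]; rfl

/-- Submultiplicativity of the `ℓ¹`-norm. -/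
theorem l1_mul_le (G H : MvPolynomial σ ℤ) : l1 (G * H) ≤ l1 G * l1 H := by
  classical
  conv_lhs => rw [← MvPolynomial.support_sum_monomial_coeff G, ← MvPolynomial.support_sum_monomial_coeff H,
    Finset.sum_mul_sum]
  refine (l1_sum_le _ _).trans ?_
  show _ ≤ (G.support.sum fun a => (G.coeff a).natAbs) * (H.support.sum fun b => (H.coeff b).natAbs)
  rw [Finset.sum_mul_sum]
  refine Finset.sum_le_sum fun a _ => (l1_sum_le _ _).trans (Finset.sum_le_sum fun b _ => le_of_eq ?_)
  rw [MvPolynomial.monomial_mul, l1_monomial, Int.natAbs_mul]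

/-- `l1 (G ^ k) ≤ l1 G ^ k`. -/
theorem l1_pow_le (G : MvPolynomial σ ℤ) (k : ℕ) : l1 (G ^ k) ≤ l1 G ^ k := by
  induction k with
  | zero => rw [pow_zero, pow_zero, l1_one]
  | succ k ih => rw [pow_succ, pow_succ]; exact (l1_mul_le _ _).trans (Nat.mul_le_mul ih le_rfl)

/-- `l1` is submultiplicative over finite products. -/
theorem l1_prod_le {ι : Type*} (s : Finset ι) (f : ι → MvPolynomial σ ℤ) :
    l1 (∏ i ∈ s, f i) ≤ ∏ i ∈ s, l1 (f i) := by
  classical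
  induction s using Finset.induction_on with
  | empty => rw [Finset.prod_empty, Finset.prod_empty, l1_one]
  | @insert a s ha ih =>
    rw [Finset.prod_insert ha, Finset.prod_insert ha]
    exact (l1_mul_le _ _).trans (Nat.mul_le_mul le_rfl ih)

/-- `‖G‖₂² ≤ ‖G‖₁²`: the sum of the squared coefficients is at most the square of the `ℓ¹`-norm. -/
theorem sum_sq_coeff_le_l1_sq (G : MvPolynomial σ ℤ) : (∑ m ∈ G.support, G.coeff m ^ 2) ≤ ((l1 G : ℕ) : ℤ) ^ 2 := by
  rw [l1, Nat.cast_sum]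
  simp_rw [Int.natCast_natAbs]
  calc ∑ m ∈ G.support, G.coeff m ^ 2 = ∑ m ∈ G.support, |G.coeff m| ^ 2 := Finset.sum_congr rfl fun m _ => (sq_abs _).symm
    _ ≤ (∑ m ∈ G.support, |G.coeff m|) ^ 2 := Finset.sum_sq_le_sq_sum_of_nonneg fun m _ => abs_nonneg _

/-- (private: print-twin of the rank-3 file's `RootDecomp1HCycles.card_support_le_pow`, gate dedup) A polynomial of total degree `≤ D` in finitely many variables `τ` has at most `(D + 1)^{#τ}` monomials. -/
private theorem card_support_le_pow {τ : Type*} [Fintype τ] [DecidableEq τ] (P : MvPolynomial τ ℤ) {D : ℕ}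
    (hP : P.totalDegree ≤ D) : P.support.card ≤ (D + 1) ^ Fintype.card τ := by
  classical
  let f : (τ →₀ ℕ) → (τ → Fin (D + 1)) := fun m s => ⟨min (m s) D, by omega⟩
  have hle : ∀ m ∈ P.support, ∀ s, m s ≤ D := fun m hm s =>
    (MvPolynomial.monomial_le_degreeOf s hm).trans ((MvPolynomial.degreeOf_le_totalDegree P s).trans hP)
  have hinj : Set.InjOn f P.support := by
    intro m hm m' hm' h
    ext s
    have := congrArg (fun g : τ → Fin (D + 1) => ((g s : Fin (D + 1)) : ℕ)) h
    simpa [f, min_eq_left (hle m hm s), min_eq_left (hle m' hm' s)] using this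
  calc P.support.card ≤ (Finset.univ : Finset (τ → Fin (D + 1))).card :=
        Finset.card_le_card_of_injOn f (fun _ _ => Finset.mem_coe.2 (Finset.mem_univ _)) hinj
    _ = (D + 1) ^ Fintype.card τ := by simp

/-- THE CRUDE KERNEL HEIGHT CONSTANT at rank `n` and size `D`: `(D + 1)^{2n} · D · 2^D` (`= 10⁶, 2.5·10⁷, 6.25·10⁸` at
`D = 4`, `n = 3, 4, 5`). -/
def hBound (n D : ℕ) : ℕ := (D + 1) ^ (n + n) * (D * 2 ^ D)

/-- `hBound 3 4 = 1000000`. -/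
theorem hBound_three : hBound 3 4 = 1000000 := by norm_num [hBound]

/-- `hBound 4 4 = 25000000`. -/
theorem hBound_four : hBound 4 4 = 25000000 := by norm_num [hBound]

/-- `hBound 5 4 = 625000000`. -/
theorem hBound_five : hBound 5 4 = 625000000 := by norm_num [hBound]

/-- The gauge of the live items at `c⋆ = 1`: `stdGauge n 1 = 4`. -/
theorem stdGauge_one (n : ℕ) : stdGauge n 1 = 4 := rfl

variable {n : ℕ} [NeZero n] {ε c : Fin n → ℤ} {y : Fin n → ℂ}

/-- The substitution images of the variables have `ℓ¹`-norm `≤ 2` for unit parameters. -/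
theorem l1_substFunN_le (hp : UnitParamsN ε c) (s : Fin n ⊕ Fin n) : l1 (substFunN ε c s) ≤ 2 := by
  rcases s with j | j
  · rw [substFunN_inl]
    refine (l1_add_le _ _).trans ?_
    have h1 : l1 (MvPolynomial.C (ε (j - 1)) * MvPolynomial.X (j - 1) : MvPolynomial (Fin n) ℤ) ≤ 1 :=
      (l1_mul_le _ _).trans (by
        rw [l1_C, l1_X, mul_one]
        rcases hp.1 (j - 1) with h | h <;> simp [h])
    have h2 : l1 (MvPolynomial.C (c (j - 1)) : MvPolynomial (Fin n) ℤ) ≤ 1 := by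
      rw [l1_C]; rcases hp.2 (j - 1) with h | h | h <;> simp [h]
    omega
  · rw [substFunN_inr, l1_X]; norm_num

/-- `ℓ¹`-inflation under the cyclic substitution: `‖cycSubstN P‖₁ ≤ Σ_d |p_d| · 2^{|d|}`. -/
theorem l1_cycSubstN_le (hp : UnitParamsN ε c) (P : MvPolynomial (Fin n ⊕ Fin n) ℤ) :
    l1 (cycSubstN ε c P) ≤ ∑ d ∈ P.support, (P.coeff d).natAbs * 2 ^ (d.sum fun _ e => e) := by
  classical
  rw [cycSubstN, MvPolynomial.aeval_eq_eval₂Hom, MvPolynomial.coe_eval₂Hom, MvPolynomial.eval₂_eq']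
  refine (l1_sum_le _ _).trans (Finset.sum_le_sum fun d _ => ?_)
  rw [MvPolynomial.algebraMap_eq]
  refine (l1_mul_le _ _).trans ?_
  rw [l1_C]
  refine Nat.mul_le_mul le_rfl ((l1_prod_le _ _).trans ?_)
  calc ∏ i, l1 (substFunN ε c i ^ d i) ≤ ∏ i, 2 ^ d i :=
        Finset.prod_le_prod (fun i _ => Nat.zero_le _) fun i _ =>
          (l1_pow_le _ _).trans (Nat.pow_le_pow_left (l1_substFunN_le hp i) _)
    _ = 2 ^ ∑ i, d i := Finset.prod_pow_eq_pow_sum _ _ _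
    _ = 2 ^ (d.sum fun _ e => e) := by rw [Finsupp.sum_fintype _ _ (fun _ => rfl)]

/-- **`ℓ¹`-INFLATION IS BOUNDED**: for unit parameters the cyclic image of a size-`≤ D` integer polynomial has `ℓ¹`-norm
`≤ hBound n D` (`(D+1)^{2n}` monomials × height `D` × inflation `2^D`). -/
theorem l1_cycSubstN_le_hBound (hp : UnitParamsN ε c) {P : MvPolynomial (Fin n ⊕ Fin n) ℤ} {D : ℕ} (hP : psize P ≤ D) :
    l1 (cycSubstN ε c P) ≤ hBound n D := by
  classical
  have hdeg : P.totalDegree ≤ D := (le_max_left _ _).trans hP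
  have hcoef : ∀ d ∈ P.support, (P.coeff d).natAbs ≤ D := fun d hd =>
    (Finset.le_sup (f := fun d => (P.coeff d).natAbs) hd).trans ((le_max_right _ _).trans hP)
  refine (l1_cycSubstN_le hp P).trans ?_
  calc ∑ d ∈ P.support, (P.coeff d).natAbs * 2 ^ (d.sum fun _ e => e)
        ≤ ∑ d ∈ P.support, D * 2 ^ D := Finset.sum_le_sum fun d hd =>
          Nat.mul_le_mul (hcoef d hd) (Nat.pow_le_pow_right (by norm_num) ((MvPolynomial.le_totalDegree hd).trans hdeg))
    _ = P.support.card * (D * 2 ^ D) := by rw [Finset.sum_const, smul_eq_mul]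
    _ ≤ (D + 1) ^ (n + n) * (D * 2 ^ D) :=
          Nat.mul_le_mul_right _ ((card_support_le_pow P hdeg).trans_eq (by simp [Fintype.card_sum]))
    _ = hBound n D := rfl

/-- … hence height `≤ hBound n D`. -/
theorem height_cycSubstN_le (hp : UnitParamsN ε c) {P : MvPolynomial (Fin n ⊕ Fin n) ℤ} {D : ℕ} (hP : psize P ≤ D)
    (m : Fin n →₀ ℕ) : ((cycSubstN ε c P).coeff m).natAbs ≤ hBound n D :=
  (natAbs_coeff_le_l1 _ m).trans (l1_cycSubstN_le_hBound hp hP)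

/-- IMAGE EXCLUSION at `u` (sup-norm form): no non-zero integer polynomial in `U_0, …, U_{n−1}` of total degree `≤ D` and
height `≤ H` vanishes at `u`. -/
def ImgExclN (u : Fin n → ℂ) (D H : ℕ) : Prop :=
  ∀ G : MvPolynomial (Fin n) ℤ, G.totalDegree ≤ D → (∀ m, (G.coeff m).natAbs ≤ H) → MvPolynomial.aeval u G = 0 → G = 0

/-- **EUCLIDEAN IMAGE EXCLUSION** — the census certificate LITERALLY (FLINT/fpLLL + exact Gram–Schmidt lower bound `λ₁ > H`:
no non-zero integer relation vector of EUCLIDEAN norm `≤ H` among the monomials of degree `≤ D` at `u`): no non-zero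
`G ∈ ℤ[U]` of total degree `≤ D` with `Σ_m (coeff_m G)² ≤ H²` vanishes at `u`. -/
def EuclExclN (u : Fin n → ℂ) (D H : ℕ) : Prop :=
  ∀ G : MvPolynomial (Fin n) ℤ, G.totalDegree ≤ D → (∑ m ∈ G.support, G.coeff m ^ 2) ≤ (H : ℤ) ^ 2 →
    MvPolynomial.aeval u G = 0 → G = 0

/-- **SUP-NORM IMAGE EXCLUSION ⟹ SOURCE EXCLUSION** at size `D`, for any certified height `H ≥ hBound n D`. -/
theorem srcExclN_of_imgExclN (hp : UnitParamsN ε c) {u : Fin n → ℂ} {D H : ℕ} (hH : hBound n D ≤ H)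
    (h : ImgExclN u D H) : SrcExclN ε c u D := fun P hP hval =>
  h _ ((totalDegree_cycSubstN_le P).trans ((le_max_left _ _).trans hP))
    (fun m => (height_cycSubstN_le hp hP m).trans hH) hval

/-- **EUCLIDEAN IMAGE EXCLUSION ⟹ SOURCE EXCLUSION** at size `D`, for any certified Euclidean bound `H ≥ hBound n D`
(`‖image‖₂ ≤ ‖image‖₁ ≤ hBound n D`; no extra monomial-count factor). -/
theorem srcExclN_of_euclExclN (hp : UnitParamsN ε c) {u : Fin n → ℂ} {D H : ℕ} (hH : hBound n D ≤ H)
    (h : EuclExclN u D H) : SrcExclN ε c u D := fun P hP hval =>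
  h _ ((totalDegree_cycSubstN_le P).trans ((le_max_left _ _).trans hP))
    ((sum_sq_coeff_le_l1_sq _).trans (by exact_mod_cast Nat.pow_le_pow_left ((l1_cycSubstN_le_hBound hp hP).trans hH) 2))
    hval

/-- **THE LIVE INSTRUMENT AT A CERTIFIED UNIT `n`-CYCLE**: the `(n, 1, y)`-instance of `FinCSAt g` follows from the census
certificate `EuclExclN (e^y) (g n 1) H`, `H ≥ hBound n (g n 1)` (for `g = stdGauge`: `EuclExclN (e^y) 4 H`, `H ≥ hBound n 4`). -/
theorem finCS_cell_of_euclExclN (h : IsIntCycleN ε c y) (hp : UnitParamsN ε c) {g : ℕ → ℕ → ℕ} {H : ℕ}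
    (hH : hBound n (g n 1) ≤ H) (hex : EuclExclN (cexp ∘ y) (g n 1) H) :
    LowerRanks n → NearOpt n 1 y → ConjStable y →
      (¬ LinearIndependent ℚ y ∨
        ¬ ∃ P : Fin (n + 1) → MvPolynomial (Fin n ⊕ Fin n) ℤ, (∀ i, psize (P i) ≤ g n 1) ∧ IsCertificate n y P) :=
  finCS_cell_of_srcExclN h (srcExclN_of_euclExclN hp hH hex)

/-- … and there the `(n, 1, y)`-instance of the residual `BridgeAt g` reads EXACTLY «`LowerRanks n →` `y` is not a
counterexample». -/
theorem bridge_cell_iff_of_euclExclN (h : IsIntCycleN ε c y) (hp : UnitParamsN ε c) {g : ℕ → ℕ → ℕ} {H : ℕ}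
    (hH : hBound n (g n 1) ≤ H) (hex : EuclExclN (cexp ∘ y) (g n 1) H) (hopt : NearOpt n 1 y) (hcs : ConjStable y)
    (hnh : ¬ InTowerHull y) :
    (LowerRanks n → NearOpt n 1 y → ConjStable y → CounterEx y → ¬ InTowerHull y →
        ∃ P : Fin (n + 1) → MvPolynomial (Fin n ⊕ Fin n) ℤ, (∀ i, psize (P i) ≤ g n 1) ∧ IsCertificate n y P) ↔
      (LowerRanks n → ¬ CounterEx y) :=
  bridge_cell_iffN h (srcExclN_of_euclExclN hp hH hex) hopt hcs hnh

/-- The sup-norm variants. -/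
theorem finCS_cell_of_imgExclN (h : IsIntCycleN ε c y) (hp : UnitParamsN ε c) {g : ℕ → ℕ → ℕ} {H : ℕ}
    (hH : hBound n (g n 1) ≤ H) (hex : ImgExclN (cexp ∘ y) (g n 1) H) :
    LowerRanks n → NearOpt n 1 y → ConjStable y →
      (¬ LinearIndependent ℚ y ∨
        ¬ ∃ P : Fin (n + 1) → MvPolynomial (Fin n ⊕ Fin n) ℤ, (∀ i, psize (P i) ≤ g n 1) ∧ IsCertificate n y P) :=
  finCS_cell_of_srcExclN h (srcExclN_of_imgExclN hp hH hex)

/-- On a cell point `y` (integer unit `n`-cycle, near-optimal, conjugation-stable, off the tower hull) carrying a sup-norm image-exclusion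
certificate `ImgExclN (e^y) (g n 1) H` with `H ≥ hBound n (g n 1)`, the residual `BridgeTransverse` instance reads exactly
`LowerRanks n → ¬ CounterEx y`. -/
theorem bridge_cell_iff_of_imgExclN (h : IsIntCycleN ε c y) (hp : UnitParamsN ε c) {g : ℕ → ℕ → ℕ} {H : ℕ}
    (hH : hBound n (g n 1) ≤ H) (hex : ImgExclN (cexp ∘ y) (g n 1) H) (hopt : NearOpt n 1 y) (hcs : ConjStable y)
    (hnh : ¬ InTowerHull y) :
    (LowerRanks n → NearOpt n 1 y → ConjStable y → CounterEx y → ¬ InTowerHull y →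
        ∃ P : Fin (n + 1) → MvPolynomial (Fin n ⊕ Fin n) ℤ, (∀ i, psize (P i) ≤ g n 1) ∧ IsCertificate n y P) ↔
      (LowerRanks n → ¬ CounterEx y) :=
  bridge_cell_iffN h (srcExclN_of_imgExclN hp hH hex) hopt hcs hnh

end height

end Summit.Schanuel.Schanuel.Theorems.RootDecomp1HSpine
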